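import Summits.ResolutionOfSingularities.ResolutionOfSingularities.Theorems.HilbertSamuelEliminationSigmaMaxModificationsCorridor3WLadderIsoTailsArcStrictTransforms
import Mathlib.RingTheory.Ideal.Maps
import HarnessLib

/-!
# [OURS · L1 W4.2 · D14 «K1 FREE-RATIONAL TAILS»] The arc lemma for FREE-RATIONAL steps: translated strict transforms
# `g_j(t, t y + a_{j+1} t) = t^m g_{j+1}` force `h ∈ (y − Σ_k a_k t^k)^m` (crux `SigmaMaxModifications` stmt-ResolutionOfSingularities-18506 /
# conjunct stmt-…-19249; kernel `IsoQuadraticTowerTerminates p 3`, card C5 K1; D14-BRIDGE-CUT object H6 (d))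

Lead prover res-L1-w42-lead-1 (gen 4), deal D14; sequel of `…Corridor3WLadderIsoTailsArcStrictTransforms` (p519093) and
`…IsoTailsArcDivisibility` (p518247). Helper file `--supports stmt-ResolutionOfSingularities-19249 --as helper`; kernel only, no named fact;
the definitions `tSeries`, `transChartSubst`, `shearSubst`, `IsPureT` are proof bookkeeping of this file. OURS (cell res-hironaka, slot W4.2);
NOT statements of [Hironaka2017] nor of [CossartJannsenSaito2020] / [CossartPiltant2009]. AI-written; AI review is weaker than expert review.

## What is proved (every commutative ring `K`, every `m`; in `K⟦t, y₁, y₂, y₃⟧`)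

A FREE-RATIONAL step of a point tower reads, in the `t`-chart of the regular ambient, as the chart substitution followed by a
`κ`-RATIONAL TRANSLATION: `y_i ↦ t·y_i + a_i t` (`transChartSubst a`). If the successive strict transforms along an infinite
free-rational tail satisfy `g_j(t, t y + a_{j+1} t) = t^m · g_{j+1}(t, y)` (multiplicity `m` kept), then

* `Series.mem_pow_of_translatedStrictTransforms` — **`h = g_0 ∈ (y₁ − Σ_{k≥1} a_{k,1} t^k, y₂ − Σ_k a_{k,2} t^k, y₃ − Σ_k a_{k,3} t^k)^m`**:
  the formal arc `y = Σ_{k ≥ 1} a_k t^k` OSCULATED by the tail lies in the multiplicity-`m` locus of `h`.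

Mechanism: the SHEAR `θ_j : y ↦ y + Σ_{k≥1} a_{j+k} t^k` (`shearSubst`) conjugates the translated step into the plain chart step
(`Series.subst_chart_subst_shear`: `(subst chart₁) ∘ θ_j = θ_{j+1} ∘ (subst (transChart a_{j+1}))`, because
`t·Σ_{k≥1} a_{j+1+k} t^k + a_{j+1} t = Σ_{k≥1} a_{j+k} t^k`), so the sheared transforms `θ_j g_j` satisfy the plain recursion of
`…ArcStrictTransforms` and `θ_0 h ∈ (y)^m` (`Series.mem_pow_of_strictTransforms`); the opposite shear `θ_0⁻¹ = shear(−a)` is a ring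
automorphism (`Series.subst_shear_neg_subst_shear`) carrying `(y)^m` onto `(y − Σ a_k t^k)^m` (`Ideal.map_pow`, `Ideal.map_span`).

What remains for K1 on the scheme side (D14-BRIDGE-CUT ROUTE H): produce, from an isolated point tower with an eventually free-rational
tail whose stage-`n₀` stalk is a hypersurface `R/(h)` (`R` regular local of dimension `4`), a power-series presentation `R̂ ≅ κ⟦t, y⟧`
(coefficient field + r.s.p.; H6 (a)(b)) in which the stalks of the tower are the iterated translated `t`-charts with constants
`a_j ∈ κ` (H4/H5) and the strict transforms keep multiplicity `m` (H1/H3); then this file gives the arc in the multiplicity-`m` locus of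
`Spec R̂/(h)`, against isolation (H7/H8).

References: idea-1 card C5 (Sketch d9de4647629be5a3); V. Cossart, O. Piltant, J. Algebra 321 (2009) ch. 3 I.9 [CossartPiltant2009];
E. Casas-Alvero, *Singularities of plane curves*, LMS LN 276 (2000), ch. 3 (free points and the osculating branch).
-/

noncomputable section

set_option linter.dupNamespace false -- mandated namespace of this single-conjunct summit

open MvPowerSeries

namespace Summit.ResolutionOfSingularities.ResolutionOfSingularities.Cruxes.SigmaMaxModifications.IdeasL1C5

universe u

namespace Series

variable {K : Type u} [CommRing K]

/-! ### Series in `t` alone -/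

/-- «pure `t`-power»: the exponent `e` involves only the variable `t` (index `0`). [folklore] -/
def IsPureT (e : Fin 4 →₀ ℕ) : Prop := e 1 = 0 ∧ e 2 = 0 ∧ e 3 = 0


/-- A pure `t`-exponent is `single 0 (e 0)`. [folklore] -/
theorem isPureT_iff_eq_single (e : Fin 4 →₀ ℕ) : IsPureT e ↔ e = Finsupp.single 0 (e 0) := by
  constructor
  · intro h
    ext i
    fin_cases i
    · simp
    · simpa using h.1
    · simpa using h.2.1
    · simpa using h.2.2
  · intro h
    refine ⟨?_, ?_, ?_⟩ <;> (rw [h]; simp)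

/-- `single 0 k` is a pure `t`-exponent. [folklore] -/
theorem isPureT_single (k : ℕ) : IsPureT (Finsupp.single (0 : Fin 4) k) := by
  refine ⟨?_, ?_, ?_⟩ <;> simp

open Classical in
/-- The series `Σ_{k ≥ 1} f k · t^k` in `K⟦t, y₁, y₂, y₃⟧` (no constant term; `f 0` is not read). [folklore] -/
def tSeries (f : ℕ → K) : MvPowerSeries (Fin 4) K :=
  fun e => if IsPureT e ∧ 0 < e 0 then f (e 0) else 0

open Classical in
/-- Unfolding the coefficients of `tSeries`. [folklore] -/
theorem coeff_tSeries (f : ℕ → K) (e : Fin 4 →₀ ℕ) :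
    coeff e (tSeries f) = if IsPureT e ∧ 0 < e 0 then f (e 0) else 0 :=
  rfl

/-- `tSeries f` has no constant term. [folklore] -/
theorem constantCoeff_tSeries (f : ℕ → K) : constantCoeff (tSeries f) = 0 := by
  rw [← coeff_zero_eq_constantCoeff_apply, coeff_tSeries, if_neg]
  simp

/-- `tSeries f` only reads `f k` for `k ≥ 1`. [folklore] -/
theorem tSeries_congr {f f' : ℕ → K} (h : ∀ k, 0 < k → f k = f' k) : tSeries f = tSeries f' := by
  ext e
  simp only [coeff_tSeries]
  split_ifs with he
  · exact h _ he.2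
  · rfl

/-- Additivity of `tSeries`. [folklore] -/
theorem tSeries_add (f f' : ℕ → K) : tSeries f + tSeries f' = tSeries (f + f') := by
  ext e
  simp only [map_add, coeff_tSeries, Pi.add_apply]
  split_ifs <;> simp

/-- `tSeries (−f) = −tSeries f`. [folklore] -/
theorem tSeries_neg (f : ℕ → K) : tSeries (-f) = -tSeries f := by
  ext e
  simp only [map_neg, coeff_tSeries, Pi.neg_apply]
  split_ifs <;> simp

/-- `t · (Σ_{k≥1} f k t^k) + c · t = Σ_{k≥1} f′ k t^k` with `f′ 1 = c`, `f′ (k+1) = f k`. [folklore] -/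
theorem X_mul_tSeries_add_C_mul_X (f : ℕ → K) (c : K) :
    X 0 * tSeries f + C c * X 0 = tSeries (fun k => if k = 1 then c else f (k - 1)) := by
  ext e
  have hX1 : (X 0 : MvPowerSeries (Fin 4) K) = monomial (Finsupp.single 0 1) 1 := by
    rw [← X_pow_eq (0 : Fin 4) 1, pow_one]
  rw [map_add, hX1, coeff_monomial_mul, one_mul, coeff_C_mul, coeff_monomial, coeff_tSeries, coeff_tSeries]
  by_cases hp : IsPureT e
  · have hp' : IsPureT (e - Finsupp.single 0 1) := by
      refine ⟨?_, ?_, ?_⟩ <;> simp [hp.1, hp.2.1, hp.2.2]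
    have hle : Finsupp.single (0 : Fin 4) 1 ≤ e ↔ 1 ≤ e 0 := Finsupp.single_le_iff
    have heq : (e = Finsupp.single 0 1) ↔ e 0 = 1 := by
      constructor
      · intro h; rw [h]; simp
      · intro h; rw [(isPureT_iff_eq_single e).mp hp, h]
    simp only [hp', true_and, hp, heq, Finsupp.coe_tsub, Pi.sub_apply, Finsupp.single_eq_same, hle]
    set k := e 0 with hk
    by_cases h0 : k = 0
    · simp [h0]
    by_cases h1 : k = 1
    · simp [h1]
    have h2 : 2 ≤ k := by omega
    rw [if_pos (by omega), if_pos (by omega), if_neg h1, if_pos (by omega), if_neg h1]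
    simp
  · -- not a pure `t`-power: every term vanishes
    have hp' : ¬ IsPureT (e - Finsupp.single 0 1) := by
      intro h; apply hp
      refine ⟨?_, ?_, ?_⟩
      · have := h.1; simpa using this
      · have := h.2.1; simpa using this
      · have := h.2.2; simpa using this
    have hne : e ≠ Finsupp.single 0 1 := fun h => hp (h ▸ isPureT_single 1)
    simp [hp, hp', hne]

/-- Substituting a family that fixes `t` into a series in `t` alone does nothing. [folklore] -/
theorem subst_tSeries_of_apply_zero {a : Fin 4 → MvPowerSeries (Fin 4) K} (ha : HasSubst a) (h0 : a 0 = X 0)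
    (f : ℕ → K) : subst a (tSeries f) = tSeries f := by
  ext e
  rw [coeff_subst ha]
  -- only pure-`t` exponents `d` with `d 0 > 0` contribute, and then `∏ (a i)^{d i} = t^{d 0} = monomial d 1`
  have hprod : ∀ d : Fin 4 →₀ ℕ, IsPureT d → (d.prod fun i k => a i ^ k) = monomial d (1 : K) := by
    intro d hd
    rw [(isPureT_iff_eq_single d).mp hd, Finsupp.prod_single_index (by simp), h0, X_pow_eq]
  by_cases he : IsPureT e ∧ 0 < e 0
  · rw [finsum_eq_single _ e]
    · rw [hprod e he.1, coeff_monomial_same, coeff_tSeries, if_pos he, smul_eq_mul, mul_one]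
    · intro d hd
      rw [coeff_tSeries]
      split_ifs with hd'
      · rw [hprod d hd'.1, coeff_monomial, if_neg (Ne.symm hd), smul_zero]
      · rw [zero_smul]
  · rw [coeff_tSeries, if_neg he]
    apply finsum_eq_zero_of_forall_eq_zero
    intro d
    rw [coeff_tSeries]
    split_ifs with hd'
    · rw [hprod d hd'.1, coeff_monomial, if_neg, smul_zero]
      rintro rfl
      exact he hd'
    · rw [zero_smul]

/-! ### The translated chart step and the shear -/

/-- The FREE-RATIONAL step: the `t`-chart followed by the `κ`-rational translation `c`: `t ↦ t`, `y_i ↦ t·y_i + c_i·t`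
(`i = 1, 2, 3`; `c 0` is not read). [folklore] -/
def transChartSubst (c : Fin 4 → K) : Fin 4 → MvPowerSeries (Fin 4) K :=
  fun i => if i = 0 then X 0 else X 0 * X i + C (c i) * X 0

/-- The SHEAR along the arc: `t ↦ t`, `y_i ↦ y_i + Σ_{k≥1} b k i · t^k`. [folklore] -/
def shearSubst (b : ℕ → Fin 4 → K) : Fin 4 → MvPowerSeries (Fin 4) K :=
  fun i => if i = 0 then X 0 else X i + tSeries (fun k => b k i)

/-- The translated chart family can be substituted (zero constant terms). [folklore] -/
theorem hasSubst_transChartSubst (c : Fin 4 → K) : HasSubst (transChartSubst c) :=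
  hasSubst_of_constantCoeff_zero fun i => by
    unfold transChartSubst
    split_ifs <;> simp

/-- The shear family can be substituted (zero constant terms). [folklore] -/
theorem hasSubst_shearSubst (b : ℕ → Fin 4 → K) : HasSubst (shearSubst b) :=
  hasSubst_of_constantCoeff_zero fun i => by
    unfold shearSubst
    split_ifs <;> simp [constantCoeff_tSeries]

/-- `t ↦ t`. [folklore] -/
theorem transChartSubst_apply_zero (c : Fin 4 → K) : transChartSubst c 0 = X 0 := by simp [transChartSubst]

/-- `y_i ↦ t y_i + c_i t`. [folklore] -/
theorem transChartSubst_apply_of_ne (c : Fin 4 → K) {i : Fin 4} (hi : i ≠ 0) :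
    transChartSubst c i = X 0 * X i + C (c i) * X 0 := by simp [transChartSubst, hi]

/-- `t ↦ t`. [folklore] -/
theorem shearSubst_apply_zero (b : ℕ → Fin 4 → K) : shearSubst b 0 = X 0 := by simp [shearSubst]

/-- `y_i ↦ y_i + Σ_k b_{k,i} t^k`. [folklore] -/
theorem shearSubst_apply_of_ne (b : ℕ → Fin 4 → K) {i : Fin 4} (hi : i ≠ 0) :
    shearSubst b i = X i + tSeries (fun k => b k i) := by simp [shearSubst, hi]

/-- **Shearing conjugates the translated step into the plain chart step**: with `θ_j = shear (k ↦ a (j+k))`,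
`[g(t, t y + a_{j+1} t)] ∘ θ_{j+1}`-wise: `subst chart₁ (subst θ_j g) = subst θ_{j+1} (subst (transChart (a (j+1))) g)`. [folklore] -/
theorem subst_chart_subst_shear (a : ℕ → Fin 4 → K) (j : ℕ) (g : MvPowerSeries (Fin 4) K) :
    subst (chartSubstSeries K 1) (subst (shearSubst fun k => a (j + k)) g) =
      subst (shearSubst fun k => a (j + 1 + k)) (subst (transChartSubst (a (j + 1))) g) := by
  rw [subst_comp_subst_apply (hasSubst_shearSubst _) (hasSubst_chartSubstSeries 1),
    subst_comp_subst_apply (hasSubst_transChartSubst _) (hasSubst_shearSubst _)]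
  congr 1
  funext i
  by_cases hi : i = 0
  · subst hi
    rw [shearSubst_apply_zero, transChartSubst_apply_zero, subst_X (hasSubst_chartSubstSeries 1),
      subst_X (hasSubst_shearSubst _), chartSubstSeries_apply_zero, shearSubst_apply_zero]
  · rw [shearSubst_apply_of_ne _ hi, transChartSubst_apply_of_ne _ hi,
      subst_add (hasSubst_chartSubstSeries 1), subst_X (hasSubst_chartSubstSeries 1),
      chartSubstSeries_apply_of_ne _ hi, pow_one,
      subst_tSeries_of_apply_zero (hasSubst_chartSubstSeries 1) (chartSubstSeries_apply_zero 1),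
      subst_add (hasSubst_shearSubst _), subst_mul (hasSubst_shearSubst _), subst_mul (hasSubst_shearSubst _),
      subst_X (hasSubst_shearSubst _), subst_X (hasSubst_shearSubst _), subst_C,
      shearSubst_apply_zero, shearSubst_apply_of_ne _ hi, mul_add, add_assoc, X_mul_tSeries_add_C_mul_X]
    congr 1
    apply tSeries_congr
    intro k hk
    by_cases h1 : k = 1
    · subst h1; simp
    · rw [if_neg h1]; congr 1; omega

/-- Shear followed by the opposite shear is the identity. [folklore] -/
theorem subst_shear_neg_subst_shear (b : ℕ → Fin 4 → K) (g : MvPowerSeries (Fin 4) K) :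
    subst (shearSubst fun k i => -b k i) (subst (shearSubst b) g) = g := by
  rw [subst_comp_subst_apply (hasSubst_shearSubst _) (hasSubst_shearSubst _)]
  have : (fun i => subst (shearSubst fun k i => -b k i) (shearSubst b i)) = MvPowerSeries.X := by
    funext i
    by_cases hi : i = 0
    · subst hi
      rw [shearSubst_apply_zero, subst_X (hasSubst_shearSubst _), shearSubst_apply_zero]
    · rw [shearSubst_apply_of_ne _ hi, subst_add (hasSubst_shearSubst _), subst_X (hasSubst_shearSubst _),
        subst_tSeries_of_apply_zero (hasSubst_shearSubst _) (shearSubst_apply_zero _), shearSubst_apply_of_ne _ hi,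
        add_assoc, tSeries_add]
      have h0 : ((fun k => -b k i) + fun k => b k i) = 0 := by funext k; simp
      rw [h0]
      simp [MvPowerSeries.ext_iff, coeff_tSeries]
  rw [this, subst_self]; rfl


/-- **[OURS · L1 W4.2 · D14 / H6(d)] THE ARC LEMMA FOR FREE-RATIONAL STEPS.** If `g 0 = h` and for every `j` the next series
is the strict transform of `g j` at the `κ`-RATIONAL point `y = a_{j+1} t` of the `t`-chart — `g_j(t, t y + a_{j+1} t) = t^m · g_{j+1}(t, y)` —
then `h ∈ (y₁ − Σ_k a_{k,1} t^k, y₂ − Σ_k a_{k,2} t^k, y₃ − Σ_k a_{k,3} t^k)^m`: the formal arc `y = Σ_{k≥1} a_k t^k` osculated by the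
free-rational tail lies in the multiplicity-`m` locus of `h`. [cite: CossartPiltant2009, ch. 3 I.9] -/
theorem mem_pow_of_translatedStrictTransforms (h : MvPowerSeries (Fin 4) K) (m : ℕ) (a : ℕ → Fin 4 → K)
    (g : ℕ → MvPowerSeries (Fin 4) K) (hg0 : g 0 = h)
    (hstep : ∀ j, subst (transChartSubst (a (j + 1))) (g j) = X 0 ^ m * g (j + 1)) :
    h ∈ (Ideal.span ({X 1 - tSeries (fun k => a k 1), X 2 - tSeries (fun k => a k 2), X 3 - tSeries (fun k => a k 3)} :
      Set (MvPowerSeries (Fin 4) K))) ^ m := by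
  -- the sheared strict transforms satisfy the PLAIN recursion
  set g' : ℕ → MvPowerSeries (Fin 4) K := fun j => subst (shearSubst fun k => a (j + k)) (g j) with hg'
  have hstep' : ∀ j, subst (chartSubstSeries K 1) (g' j) = X 0 ^ m * g' (j + 1) := by
    intro j
    simp only [hg']
    rw [subst_chart_subst_shear, hstep j, subst_mul (hasSubst_shearSubst _), subst_pow (hasSubst_shearSubst _),
      subst_X (hasSubst_shearSubst _), shearSubst_apply_zero]
  have hmem : g' 0 ∈ (Ideal.span ({X 1, X 2, X 3} : Set (MvPowerSeries (Fin 4) K))) ^ m :=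
    mem_pow_of_strictTransforms (g' 0) m g' rfl hstep'
  -- undo the shear at `j = 0`
  have hb : (fun k => a (0 + k)) = a := by funext k; rw [zero_add]
  have hh : h = subst (shearSubst fun k i => -a k i) (g' 0) := by
    simp only [hg', hb]
    rw [subst_shear_neg_subst_shear, hg0]
  have hX : ∀ {i : Fin 4}, i ≠ 0 →
      (substAlgHom (R := K) (hasSubst_shearSubst fun k i => -a k i)) (X i : MvPowerSeries (Fin 4) K) =
        X i - tSeries (fun k => a k i) := by
    intro i hi
    rw [coe_substAlgHom, subst_X (hasSubst_shearSubst _), shearSubst_apply_of_ne _ hi,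
      show (fun k => -a k i) = -(fun k => a k i) from rfl, tSeries_neg, sub_eq_add_neg]
  have himg := Ideal.mem_map_of_mem (substAlgHom (R := K) (hasSubst_shearSubst fun k i => -a k i)) hmem
  rw [Ideal.map_pow, Ideal.map_span, Set.image_insert_eq, Set.image_insert_eq, Set.image_singleton,
    hX (by decide), hX (by decide), hX (by decide), coe_substAlgHom] at himg
  rw [hh]
  exact himg

end Series

end Summit.ResolutionOfSingularities.ResolutionOfSingularities.Cruxes.SigmaMaxModifications.IdeasL1C5

end
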